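/-
Copyright (c) 2026. All rights reserved.
Released under Apache 2.0 license as described in the file LICENSE.
Authors: abc-iut cell, seat abc-iut-w6-d025 (gen 3; block C / W6, row «COR36-JOINT-TELE»), statement shape =
seat abc-iut-L4-t10's MEMO `HOME/staging/L4/abc-iut-L4-t10/g4/MEMO-Cor45-joint-witness.md` §4 verbatim.
-/
import Literature.AnabelianGeometry.AbsoluteAnabelian.AbsTopIII.FrobeniusPictureMLFTelecoreJoint
import Literature.AnabelianGeometry.AbsoluteAnabelian.AbsTopIII.FrobeniusPictureMLFLogTeleModel

/-!
# [AbsTopIII] Cor. 3.6 (ii) ∧ (iii) ∧ (v) with ONE telecore: the typed joint statement, and the MLF model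

S. Mochizuki, *Topics in Absolute Anabelian Geometry III*, Cor. 3.6 (ii), (iii) second clause, (v) fourth
sentence, pp. 79–81 (kurims manuscript `paper:url-5493eb38cbb7`; bib key `MochizukiAbsTopIII2015`).  Print has
ONE telecore `𝔗_An` with ONE contact structure `ℋ_An` to which (iii) and (v) refer (seat abc-iut-L4-t10's
finding F-L4t10g4-1 on the cell's typing: `TelecoreStmt τ`, `LogObsCompatTelecoreStmt τ`,
`ShiftTelecoreCompatStmt τ` are three SEPARATE existentials).

* `LogFrobeniusData.Cor_3_6_joint τ` — the JOINT typed statement (a successor, new name; nothing in place is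
  edited): ONE core `(𝒟_{≤5}, Anab, H)`, ONE telecore `T` of the printed shape over it, ONE family `ℋ_An` on
  `𝒟_An`, such that `ℋ_An` is THE contact structure of (ii) (compatible with `𝒥_T`, generated by the printed
  pairs, printed homotopies on the generators), ONE family on `𝒟_An` contains `𝒥_T` and a log-observable
  `𝔖_log` family ((iii), second clause, telecore half), and the `ℤ`-action `Φ_m` of (v) extends to `Ψ_m` on
  `𝒟_An` (same on `𝒟_{≤4}`, identity at `Anab`) compatibly with `𝒥_T` and `ℋ_An` ((v), fourth sentence);
  `Cor_3_6_joint.clauses` — it projects onto the three typed clauses.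
* `cor_3_6_joint_of_iotaOverGaloisStmt` — PROVED for every `Δ` with `id_⋎` fully faithful, coherent `τ` and
  `ι` over Galois (F-0360), by `joint_of_iotaOverGaloisStmt` (this seat, route (β): the telecores over `𝒳` and
  over `ℰ` carry the same `𝒥`);
* `MonoAnabelianLogFrobeniusData.cor_3_6_joint_of_iotaOverGaloisStmt` — at the printed Def-3.1 shape of the data
  (`id_⋎ = 𝟭`, `τ = ⟨φ_An, 𝟙, η_An⟩`: `toNexusFullyFaithful`, `telecoreData_coherent`) from F-0360 alone;
* **`TFModel.cor_3_6_joint_model (I)` — AT THE MLF MODEL of seat abc-iut-L4-t5's `FrobeniusPictureMLFModel.lean`,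
  UNCONDITIONAL** (F-0360 holds there: `iotaOverGaloisStmt_model`), binder `{I}` (the Cor-1.10 datum, by name);
  zero-binder instances at the non-vacuous sub-models `𝒳_{P₀}`, `𝒳_{P₀^an}`.

One `def` (the joint Prop), otherwise proof-only; nothing here takes a side on inter-universal Teichmüller theory
or bears on [IUTchIII] Cor. 3.12; typed ≠ proved; model-level ≠ node-level.
-/

namespace Literature.AnabelianGeometry.AbsoluteAnabelian

open _root_.CategoryTheory _root_.Quiver

universe u

namespace LogFrobeniusData

open DiagramOfCategories

variable (Δ : LogFrobeniusData.{u}) (τ : Δ.TelecoreData)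

/-- **[AbsTopIII] Cor. 3.6 (ii) ∧ (iii)-second-clause-telecore ∧ (v)-fourth-sentence, JOINT typed form** (one
telecore `𝔗_An`, one contact structure `ℋ_An`, shared by the three items, as in print): there are a core family `H`
on `𝒟_{≤5}` with core vertex `Anab`, a telecore `T` over it and a family `ℋ_An` on `𝒟_An` such that `T` has the
printed shape and `ℋ_An` is the contact structure of (ii) (`IsContactAn`: compatible with `𝒥_T`, generated by
`{η_{□⋎}^{±1}, η_⋏^{±1}}`, with the printed homotopies on the generators); ONE family of homotopies on `𝒟_An`
contains `𝒥_T` and, along `𝒟_{≤3} ↪ 𝒟_An`, a log-observable `𝔖_log` family; and the `ℤ`-action `Φ` of (v) by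
nexus self-equivalences extends to self-equivalences `Ψ_m` of `𝒟_An` — agreeing with `Φ_m` on `𝒟_{≤4}`, the
identity at `Anab` — each compatible (Def. 3.5 (v)) with `𝒥_T` and with `ℋ_An`.
[cite: MochizukiAbsTopIII2015, Corollary 3.6 (ii)/(iii)/(v) pp.79–80] -/
def Cor_3_6_joint : Prop :=
  ∃ H₅ hH₅ hc, ∃ (T : (Δ.sub 4).Telecore (Δ.coreObs5 H₅ hH₅) hc)
    (Hc : (Δ.teleDiagram T.J T.telMap).HomotopyFamily),
    Δ.IsTelecoreAn τ T ∧ Δ.IsContactAn τ T Hc ∧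
    (∃ K : (Δ.teleDiagram T.J T.telMap).HomotopyFamily,
      T.Jfam.CompatibleAlong (𝟭q _) K ∧
        ∃ H : Δ.sub3.HomotopyFamily, Δ.IsLogObservableFamily H ∧ H.CompatibleAlong (embLogTele T.J) K) ∧
    ∃ (Φ : ℤ → Δ.diagram.SelfEquivalence) (Ψ : ℤ → (Δ.teleDiagram T.J T.telMap).SelfEquivalence),
      Δ.IsShiftAction Φ ∧
      (∀ (m : ℤ) (a : SubVertex {a : LFVertex | a.row ≤ 4}),
        ∃ h : (Φ m).graphMap.obj a.1 ∈ {a : LFVertex | a.row ≤ 4},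
          (Ψ m).graphMap.obj ((teleShape T.J).base a) = (teleShape T.J).base ⟨_, h⟩ ∧
          HEq ((Ψ m).hom.app ((teleShape T.J).base a)) ((Φ m).hom.app a.1)) ∧
      (∀ m : ℤ, (Ψ m).graphMap.obj (teleShape T.J).obs = (teleShape T.J).obs ∧
        HEq ((Ψ m).hom.app (teleShape T.J).obs) (𝟭 Δ.A)) ∧
      (∀ m : ℤ, Nonempty ((Ψ m).hom.CompatibleWith T.Jfam T.Jfam) ∧
        Nonempty ((Ψ m).hom.CompatibleWith Hc Hc))

/-- **The joint form projects onto the three typed clauses** `TelecoreStmt τ` (ii),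
`LogObsCompatTelecoreStmt τ` ((iii), telecore half), `ShiftTelecoreCompatStmt τ` ((v), fourth sentence).
[cite: MochizukiAbsTopIII2015, Corollary 3.6 (ii)/(iii)/(v) pp.79–80] -/
theorem Cor_3_6_joint.clauses {Δ : LogFrobeniusData.{u}} {τ : Δ.TelecoreData} (h : Δ.Cor_3_6_joint τ) :
    Δ.TelecoreStmt τ ∧ Δ.LogObsCompatTelecoreStmt τ ∧ Δ.ShiftTelecoreCompatStmt τ := by
  obtain ⟨H₅, hH₅, hc, T, Hc, hT, hHc, ⟨K, hJ, H, hH, hHK⟩, Φ, Ψ, hΦ, hbase, hobs, hcompat⟩ := h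
  exact ⟨⟨H₅, hH₅, hc, T, hT, Hc, hHc⟩, ⟨H₅, hH₅, hc, T, hT, K, hJ, H, hH, hHK⟩,
    ⟨H₅, hH₅, hc, T, Hc, hT, hHc, Φ, Ψ, hΦ, hbase, hobs, hcompat⟩⟩

/-- **The joint form, PROVED over the abstract data** for `id_⋎` fully faithful, `ι` over Galois
(`IotaOverGaloisStmt`, F-0360) and coherent `τ` (`joint_of_iotaOverGaloisStmt`).
[cite: MochizukiAbsTopIII2015, Corollary 3.6 (ii)/(iii)/(v) pp.79–80] -/
theorem cor_3_6_joint_of_iotaOverGaloisStmt (hν : Δ.toNexus.FullyFaithful) (hι : Δ.IotaOverGaloisStmt)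
    (hτ : ∀ x : Δ.X₁, Δ.toNexus.map (τ.η₁.hom.app x) =
      τ.e.hom.app (Δ.κ.obj (Δ.XtoE.obj (Δ.toNexus.obj x))) ≫ Δ.η.hom.app (Δ.toNexus.obj x)) :
    Δ.Cor_3_6_joint τ :=
  Δ.joint_of_iotaOverGaloisStmt τ hν hι hτ

end LogFrobeniusData

namespace MonoAnabelianLogFrobeniusData

variable (𝔐 : MonoAnabelianLogFrobeniusData.{u})

/-- **The joint form at the printed Def-3.1 shape of the data** (`id_⋎ = 𝟭`, telecore datum `⟨φ_An, 𝟙, η_An⟩`):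
from F-0360 (`IotaOverGaloisStmt`) alone. [cite: MochizukiAbsTopIII2015, Corollary 3.6 (ii)/(iii)/(v) pp.79–80] -/
theorem cor_3_6_joint_of_iotaOverGaloisStmt (hι : 𝔐.toLogFrobeniusData.IotaOverGaloisStmt) :
    𝔐.toLogFrobeniusData.Cor_3_6_joint 𝔐.telecoreData :=
  𝔐.toLogFrobeniusData.cor_3_6_joint_of_iotaOverGaloisStmt 𝔐.telecoreData 𝔐.toNexusFullyFaithful hι
    𝔐.telecoreData_coherent

end MonoAnabelianLogFrobeniusData

namespace AbsTopIII

namespace TFModel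

variable {p : ℕ} [Fact p.Prime] {P : ObjectProperty (TFModel p)} {D : Type 1} [Category.{1} D]

/-- **[AbsTopIII] Cor. 3.6 (ii) ∧ (iii)-telecore ∧ (v)-fourth-sentence with ONE telecore, AT THE MLF MODEL —
UNCONDITIONAL**: for the model log-Frobenius data of seat abc-iut-L4-t5's `FrobeniusPictureMLFModel.lean`
(every type `P`, every Cor-1.10 datum `I`), at the printed telecore datum; F-0360 holds there
(`iotaOverGaloisStmt_model`). [cite: MochizukiAbsTopIII2015, Corollary 3.6 (ii)/(iii)/(v) pp.79–80] -/
theorem cor_3_6_joint_model (I : AnabelianInput p P D) :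
    (monoAnabelianData I).toLogFrobeniusData.Cor_3_6_joint (monoAnabelianData I).telecoreData :=
  (monoAnabelianData I).cor_3_6_joint_of_iotaOverGaloisStmt (iotaOverGaloisStmt_model I)

/-- The joint form at the non-vacuous affine sub-model `𝒳_{P₀}` (datum `AnabelianInput.ofFull`), ZERO binders.
[cite: MochizukiAbsTopIII2015, Corollary 3.6 (ii)/(iii)/(v) pp.79–80] -/
theorem cor_3_6_joint_isAffineModel :
    (monoAnabelianData (AnabelianInput.ofFull p (IsAffineModel (p := p)) full_galP_isAffineModel)).toLogFrobeniusData.Cor_3_6_joint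
      (monoAnabelianData (AnabelianInput.ofFull p (IsAffineModel (p := p)) full_galP_isAffineModel)).telecoreData :=
  cor_3_6_joint_model _

/-- The joint form at the slim sub-model `𝒳_{P₀^an}` (datum `AnabelianInput.ofFull`), ZERO binders.
[cite: MochizukiAbsTopIII2015, Corollary 3.6 (ii)/(iii)/(v) pp.79–80] -/
theorem cor_3_6_joint_isAffineModelAn :
    (monoAnabelianData (AnabelianInput.ofFull p (IsAffineModelAn (p := p)) full_galP_isAffineModelAn)).toLogFrobeniusData.Cor_3_6_joint
      (monoAnabelianData (AnabelianInput.ofFull p (IsAffineModelAn (p := p)) full_galP_isAffineModelAn)).telecoreData :=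
  cor_3_6_joint_model _

end TFModel

end AbsTopIII

end Literature.AnabelianGeometry.AbsoluteAnabelian
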